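import Literature.RepresentationTheory.HeisenbergGroup.SchrodingerBigCellSection
import Literature.RepresentationTheory.HeisenbergGroup.SchrodingerConjugate
import Literature.RepresentationTheory.HeisenbergGroup.MetaplecticBoxHom
import HarnessLib

/-!
# Complex conjugation of Weil's big-cell operator: `conj ∘ r(g) ∘ conj = r(D₀ g D₀)` with `D₀ = (x, y) ↦ (x, −y)`

Topic `RepresentationTheory/HeisenbergGroup`; namespace `Literature.RepresentationTheory.HeisenbergGroup` (that of ★
`SchrodingerBigCellSection`, ★ `SchrodingerConjugate`, ★ `MetaplecticBoxHom`).  THEOREMS ONLY (no definition, no named fact, no `sorry`, no instance,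
no global notation).  Cell `hodgecm-mathlib`, road «L1 pin» (P) of [Liu2021, Lem. D.1 (1)] (LD2-plan (g2) DEALS #1b, brick (F2)):
`--supports stmt-HodgeConjecture-24832`.

For the standard Schrödinger model `𝒮(F^ι)` of a non-archimedean local field `F` (`2` invertible), `ψ` non-trivial with
conductor exponent `m`, `μ` a Haar measure, the operators of ★ `SchrodingerPiOperators` and complex conjugation
`conjOp M = conj ∘ M ∘ conj` (★ `SchrodingerConjugate.conjOp`) satisfy

* §1 (multiplicativity is ★ `MetaplecticBoxHom.conjOp_mul`) `conjOp_unipOpPi : conj ∘ r(n(c)) ∘ conj = r(n(−c))` (`ψ̄(t) = ψ(−t)`),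
  `conjOp_leviOpPi : conj ∘ r(m(a)) ∘ conj = r(m(a))` (real normalisation `|det a|^{−1/2}`),
  `conjOp_fourierOpPi : conj ∘ r(w) ∘ conj = r(m(−1)) r(w)` (`∫ conj = conj ∫`, `Φ̂(−η)`);
* §2 the blocks and cells of `g′ = D₀ g D₀`, `D₀ = (x, y) ↦ (x, −y)` (an element of `Sp` given by the hypothesis
  `hg′ : g′ (x, y) = ((g (x, −y))₁, −(g (x, −y))₂)`): `B′ = −B`, `A′ = A`, `D′ = D`, so `g′` is in the big cell when `g` is,
  `cellB g′ = cellB g ∘ (−1)`, `γ′ = −γ`, `δ′ = −δ`;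
* §3 **`conjOp_bigCellOp`**: `conjOp (bigCellOp g) = bigCellOp g′` for `g` in the big cell.

This is [MoeglinVignerasWaldspurger1987, Chap. 2 II.1 Remarque] («`ω̄_ψ = ω_{ψ̄}`») on Weil's explicit operators
[Weil1964, n° 13 (29)]: `ψ̄ = ψ ∘ (−1)` and `−1` acts on `W = X ⊕ Y` through `D₀`.  Consumer: the scalar of the CONJUGATE
section (★ `GelbartRogawski1991.LocalConjugateSection.exists_conjSection`) relative to the big-cell operator, brick (F2) of the
(P) road.  HC_CM is proved only modulo the printed citations (2 remaining named inputs hLiu418 = stmt-HodgeConjecture-24832,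
h413 = 24833) until rung 0 closes; count-neutral.

## References
* [Weil1964] A. Weil, *Sur certains groupes d'opérateurs unitaires*, Acta Math. 111 (1964), n° 13 (29) p. 160.
* [MoeglinVignerasWaldspurger1987] C. Mœglin, M.-F. Vignéras, J.-L. Waldspurger, LNM 1291 (1987), Chap. 2 II.1 (A) and Remarque.
* [Rangarao1993] R. Ranga Rao, Pacific J. Math. 157 (1993), Lemma 3.2, (3.8)–(3.9) p. 351.
-/

set_option autoImplicit false

noncomputable section

open MeasureTheory
open scoped ComplexConjugate
open Literature.NumberTheory.Automorphic

namespace Literature.RepresentationTheory.HeisenbergGroup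

/-! ## §1 Conjugates of the three families of operators -/

section OpsAlg

variable {F : Type*} [Field F] [ValuativeRel F] [TopologicalSpace F] [IsNonarchimedeanLocalField F]
  {ι : Type*} [Fintype ι] [Invertible (2 : F)]
  {ψ : AddChar F Circle} (hl : IsLocallyConstant (⇑ψ : F → Circle))

omit [ValuativeRel F] [TopologicalSpace F] [IsNonarchimedeanLocalField F] in
/-- `½⟨x, (−c) x⟩ = −½⟨x, c x⟩`. [cite: Rangarao1993, Lemma 3.1, p. 351] -/
theorem halfForm_neg_apply (c : (ι → F) →ₗ[F] (ι → F)) (x : ι → F) : halfForm (-c) x = -halfForm c x := by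
  rw [halfForm_apply, halfForm_apply, LinearMap.neg_apply, dotProduct_neg, mul_neg]

/-- **`conj ∘ r(n(c)) ∘ conj = r(n(−c))`**: `conj ψ(−½⟨u, cu⟩) = ψ(½⟨u, cu⟩) = ψ(−½⟨u, (−c)u⟩)`.
[cite: MoeglinVignerasWaldspurger1987, Chap. 2 II.1 Remarque; Rangarao1993, Lemma 3.2 (1), (3.8), p. 351] -/
theorem conjOp_unipOpPi (c : (ι → F) →ₗ[F] (ι → F)) : conjOp (unipOpPi hl c) = unipOpPi hl (-c) := by
  apply LinearEquiv.ext; intro f; apply Subtype.ext; funext u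
  rw [conjOp_apply, coe_conjSB_apply, coe_unipOpPi_apply, coe_unipOpPi_apply, map_mul, coe_conjSB_apply,
    Complex.conj_conj, conj_coe_addChar, halfForm_neg_apply, neg_neg]

omit [Invertible (2 : F)] in
/-- **`conj ∘ r(m(a)) ∘ conj = r(m(a))`** (the normalising scalar `|det a|^{−1/2}` is real).
[cite: MoeglinVignerasWaldspurger1987, Chap. 2 II.1 Remarque; Rangarao1993, Lemma 3.2 (1), (3.8), p. 351] -/
theorem conjOp_leviOpPi (a : (ι → F) ≃ₗ[F] (ι → F)) : conjOp (leviOpPi a) = leviOpPi a := by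
  apply LinearEquiv.ext; intro f; apply Subtype.ext; funext u
  rw [conjOp_apply, coe_conjSB_apply, coe_leviOpPi_apply, coe_leviOpPi_apply, map_mul, coe_conjSB_apply,
    Complex.conj_conj, map_inv₀, Complex.conj_ofReal]

end OpsAlg

section OpsFourier

variable {F : Type*} [Field F] [ValuativeRel F] [TopologicalSpace F] [IsNonarchimedeanLocalField F]
  {ι : Type*} [Fintype ι] {ψ : AddChar F Circle}
  [MeasurableSpace F] [BorelSpace F] (μ : Measure F) [μ.IsAddHaarMeasure] {m : ℤ}

/-- **`conj ∘ r(w) ∘ conj = r(m(−1)) ∘ r(w)`**: `conj ∫ ψ(x⋅η) conj Φ(x) = ∫ ψ(−x⋅η) Φ(x) = Φ̂(−η)`.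
[cite: MoeglinVignerasWaldspurger1987, Chap. 2 II.1 Remarque; Rangarao1993, §3.1 (3.9), p. 349] -/
theorem conjOp_fourierOpPi (hψ : ψ.IsContinuousNontrivial) (hm : ψ.HasConductorExp m) :
    conjOp (fourierOpPi (ι := ι) μ hψ hm) = leviOpPi (LinearEquiv.neg F) * fourierOpPi μ hψ hm := by
  apply LinearEquiv.ext; intro f; apply Subtype.ext; funext η
  rw [conjOp_apply, coe_conjSB_apply, coe_fourierOpPi, piFourierSB_apply, LinearEquiv.mul_apply, coe_leviOpPi_neg_apply,
    coe_fourierOpPi, piFourierSB_apply, ← integral_conj]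
  congr 1
  funext x
  rw [map_mul, coe_conjSB_apply, Complex.conj_conj, conj_coe_addChar, dotProduct_neg]

end OpsFourier

/-! ## §2 Blocks and cells of `D₀ g D₀` -/

section Cells

variable {F : Type*} [Field F] {ι : Type*}
  (g g' : ((ι → F) × (ι → F)) ≃ₗ[F] ((ι → F) × (ι → F)))
  (hg' : ∀ x y : ι → F, g' (x, y) = ((g (x, -y)).1, -(g (x, -y)).2))

include hg' in
/-- `B′ = −B`. [cite: Weil1964, n° 3, p. 147] -/
theorem blockB_of_negConj (y : ι → F) : blockB g' y = -blockB g y := by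
  rw [blockB_apply, blockB_apply, hg']
  have h : ((0 : ι → F), -y) = -((0 : ι → F), y) := by rw [Prod.neg_mk, neg_zero]
  rw [h, map_neg, Prod.fst_neg]

include hg' in
/-- `A′ = A`. [cite: Weil1964, n° 3, p. 147] -/
theorem blockA_of_negConj (x : ι → F) : blockA g' x = blockA g x := by
  rw [blockA_apply, blockA_apply, hg', neg_zero]

include hg' in
/-- `D′ = D`. [cite: Weil1964, n° 3, p. 147] -/
theorem blockD_of_negConj (y : ι → F) : blockD g' y = blockD g y := by
  rw [blockD_apply, blockD_apply, hg']
  have h : ((0 : ι → F), -y) = -((0 : ι → F), y) := by rw [Prod.neg_mk, neg_zero]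
  rw [h, map_neg, Prod.snd_neg, neg_neg]

include hg' in
/-- `g′` is in the big cell when `g` is: `B′ = −B` is bijective. [cite: Weil1964, n° 7, Prop. 1, p. 152] -/
theorem blockB_bijective_of_negConj (hB : Function.Bijective (blockB g)) : Function.Bijective (blockB g') := by
  have h : (blockB g' : (ι → F) → ι → F) = (fun x => -x) ∘ blockB g := funext fun y => blockB_of_negConj g g' hg' y
  rw [h]
  exact (neg_involutive.bijective).comp hB

include hg' in
/-- `cellB g′ = cellB g ∘ (−1)` (`y ↦ −B y = B(−y)`). [cite: Weil1964, n° 7, Prop. 1, p. 152] -/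
theorem cellB_of_negConj (hB : Function.Bijective (blockB g)) (hB' : Function.Bijective (blockB g')) :
    cellB g' hB' = cellB g hB * LinearEquiv.neg F := by
  apply LinearEquiv.ext; intro y
  rw [cellB_apply, LinearEquiv.mul_apply, cellB_apply, LinearEquiv.neg_apply, map_neg, blockB_of_negConj g g' hg']

include hg' in
/-- `(cellB g′)⁻¹ x = −(cellB g)⁻¹ x`. [cite: Weil1964, n° 7, Prop. 1, p. 152] -/
theorem cellB_symm_apply_of_negConj (hB : Function.Bijective (blockB g)) (hB' : Function.Bijective (blockB g')) (x : ι → F) :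
    (cellB g' hB').symm x = -(cellB g hB).symm x := by
  apply (cellB g' hB').injective
  rw [LinearEquiv.apply_symm_apply, map_neg, cellB_apply, blockB_of_negConj g g' hg', neg_neg, ← cellB_apply g hB,
    LinearEquiv.apply_symm_apply]

include hg' in
/-- `γ′ = −γ`. [cite: Weil1964, n° 7, Prop. 1, p. 152] -/
theorem cellGamma_of_negConj (hB : Function.Bijective (blockB g)) (hB' : Function.Bijective (blockB g')) :
    cellGamma g' hB' = -cellGamma g hB := by
  apply LinearMap.ext; intro x
  rw [cellGamma_apply, LinearMap.neg_apply, cellGamma_apply, cellB_symm_apply_of_negConj g g' hg' hB hB', map_neg,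
    blockD_of_negConj g g' hg']

include hg' in
/-- `δ′ = −δ`. [cite: Weil1964, n° 7, Prop. 1, p. 152] -/
theorem cellDelta_of_negConj (hB : Function.Bijective (blockB g)) (hB' : Function.Bijective (blockB g')) :
    cellDelta g' hB' = -cellDelta g hB := by
  apply LinearMap.ext; intro x
  rw [cellDelta_apply, LinearMap.neg_apply, cellDelta_apply, blockA_of_negConj g g' hg',
    cellB_symm_apply_of_negConj g g' hg' hB hB']

end Cells

/-! ## §3 The conjugate of the big-cell operator -/

section BigCell

variable {F : Type*} [Field F] [ValuativeRel F] [TopologicalSpace F] [IsNonarchimedeanLocalField F]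
  {ι : Type*} [Fintype ι] [Invertible (2 : F)]
  {ψ : AddChar F Circle} (hl : IsLocallyConstant (⇑ψ : F → Circle))
  [MeasurableSpace F] [BorelSpace F] (μ : Measure F) [μ.IsAddHaarMeasure] {m : ℤ}

/-- **`conj ∘ r(g) ∘ conj = r(D₀ g D₀)` ON THE BIG CELL** (`D₀ = (x, y) ↦ (x, −y)`; `g′ = D₀ g D₀` given through `hg′`):
`conjOp (bigCellOp g) = bigCellOp g′`.  The word of `g′` is `n(−γ) m(−B) w n(−δ)` and `conj` turns `r(n(γ)) r(m(B)) r(w) r(n(δ))`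
into `r(n(−γ)) r(m(B)) r(m(−1)) r(w) r(n(−δ))`. [cite: MoeglinVignerasWaldspurger1987, Chap. 2 II.1 Remarque; Weil1964, n° 13 (29), p. 160] -/
theorem conjOp_bigCellOp (hψ : ψ.IsContinuousNontrivial) (hm : ψ.HasConductorExp m)
    (g g' : symplecticGroup (polar (dotProductBilin F F (m := ι))))
    (hg' : ∀ x y : ι → F, (g' : ((ι → F) × (ι → F)) ≃ₗ[F] ((ι → F) × (ι → F))) (x, y) =
      (((g : ((ι → F) × (ι → F)) ≃ₗ[F] ((ι → F) × (ι → F))) (x, -y)).1,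
        -((g : ((ι → F) × (ι → F)) ≃ₗ[F] ((ι → F) × (ι → F))) (x, -y)).2))
    (hB : Function.Bijective (blockB (g : ((ι → F) × (ι → F)) ≃ₗ[F] ((ι → F) × (ι → F))))) :
    conjOp (bigCellOp hl μ hψ hm g) = bigCellOp hl μ hψ hm g' := by
  have hB' : Function.Bijective (blockB (g' : ((ι → F) × (ι → F)) ≃ₗ[F] ((ι → F) × (ι → F)))) :=
    blockB_bijective_of_negConj _ _ hg' hB
  rw [bigCellOp_of_bijective hl μ hψ hm g hB, bigCellOp_of_bijective hl μ hψ hm g' hB', conjOp_mul, conjOp_mul,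
    conjOp_mul, conjOp_unipOpPi, conjOp_leviOpPi, conjOp_fourierOpPi, conjOp_unipOpPi,
    cellGamma_of_negConj _ _ hg' hB hB', cellDelta_of_negConj _ _ hg' hB hB', cellB_of_negConj _ _ hg' hB hB', leviOpPi_mul]
  simp only [mul_assoc]

end BigCell

end Literature.RepresentationTheory.HeisenbergGroup

end
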